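import Literature.AnabelianGeometry.EtaleTheta.Discharge.Sec5Thm57KummerTorsionOfEtaleTowerProduced
import Literature.AnabelianGeometry.EtaleTheta.Discharge.Sec5Thm57KummerTorsionOfEtaleTowerHsepPow

/-!
# [EtTh] §5, Theorem 5.7 (C)-chain: the PRODUCED-shape member torsion clause (abc-iut-L2-d4's p501240) with the REPAIRED cross-level
# separation binder `hsep^{(2l)}`

Mochizuki, *The étale theta function and its Frobenioid-theoretic manifestations*, Publ. RIMS **45** (2009)
[cite: MochizukiEtTh2009, Thm 5.7 proof p.329–330 (PDF pp.103–104); Thm 5.6 p.328 (PDF p.102); Thm 5.10 (ii) p.333 (PDF p.107);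
Cor 2.19 (iii) p.291 (PDF p.65)].
abc-iut cell, layer L2, node `EtTh:Thm5.7`; seat abc-iut-w6-d082 (gen 6), sequel to this seat's RQ7 finding FLAG-1 on p501240 (abc-iut-L2-lead
R1156/R1164 HSEP register; built 2026-08-27T05:42Z and handed over on STATUS — filed VERBATIM by abc-iut-L2-d4 (gen 8, p501240's author lineage)
under abc-iut-L2-lead R1212's key «HSEP-POW TWINS @TOWER TRUNK + @PRODUCED», the @PRODUCED half).  PROOF-ONLY (0 definitions, 0 named facts; nothing landed is edited or restated): HYPOTHESIS-WEAKENING TWINS of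
the two tower theorems of abc-iut-L2-d4's `Sec5Thm57KummerTorsionOfEtaleTowerProduced.lean` (p501240), over this seat's
`ThetaFrobenioidTower.kummerTorsion_of_etaleTower_of_hsepPow` (`Sec5Thm57KummerTorsionOfEtaleTowerHsepPow.lean`); p501240's generic lemmas
(`ThetaFrobenioid.mem_units_of_sCap_comp_inv_eq`, `psiAut_trans_symm_eq_of_mem_units`) are consumed BY NAME.

WHY.  p501240 inherits from abc-iut-w6-d049's p478416 the exponent-`2` separation binder `hsep`, which abc-iut-f-123's p497402 / p498173 show
to be UNINHABITABLE at the Tate datum of record whenever `l ∣ p − 1` (abc-iut-L2-lead R1164: «misstated binder; repaired binder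
hsep^{(2l)}; consumers swap via p498016»).  These twins perform that swap for the produced-shape knit: binder `hsepPow` (exponent `2·l`),
every other binder and both conclusions TOKEN-IDENTICAL to p501240.
RESULTS: `ThetaFrobenioidTower.kummerTorsion_of_etaleTower_of_trans_units_of_hsepPow`, `…_ofProduced_of_hsepPow`.
HONEST FRAMING: kernel-checked compositions; none of the displayed binders is proved here or asserted to hold at any model; nothing of
[EtTh] is asserted unconditionally; typed ≠ discharged; no side taken on anything downstream ([IUTchIII] Cor. 3.12 in particular).
-/

namespace Literature.AnabelianGeometry.EtaleTheta

open CategoryTheory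
open Literature.AlgebraicGeometry.Frobenioids

universe w v v' u u' u₀ v₀

namespace ThetaFrobenioidTower

section Generic

variable {C : Type u} [Category.{v} C] {D : Type u'} [Category.{v'} D] (𝔗 : ThetaFrobenioidTower.{w} C D)
  (Ψ : C ≌ C) {E : Set ℕ+} (𝒯 : ThetaEnvTower.{v} E)

/-- **The torsion clause for the produced unit `D_p`, with `hsep^{(2l)}`** — abc-iut-w6-d049's `kummerTorsion_of_etaleTower` (p478416) with the normalised
transport datum read at the re-anchored `b ≫ D_c⁻¹` (`D_c ∈ O^×(B_N)`) while (K4m) is stated at `b` (legitimate by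
`psiAut_trans_symm_eq_of_mem_units`: the (K4m) values lie in `μ_N(B_N) ⊆ O^×(B_N)`).  Every other binder VERBATIM p501240 / p478416; `hsep` (exponent `2`) replaced by `hsepPow` (exponent `2·l`), routed through this seat's `kummerTorsion_of_etaleTower_of_hsepPow`.
[cite: MochizukiEtTh2009, Thm 5.7 proof p.330 (PDF p.104); Thm 5.6 p.328 (PDF p.102); Cor 2.19 (iii) p.291 (PDF p.65)] -/
theorem kummerTorsion_of_etaleTower_of_trans_units_of_hsepPow
    -- the §5 ↔ §2 dictionary at every level `M ∈ E`
    (ι : 𝔗.PiX ≃* 𝒯.PiX) (hι : ∀ y : 𝔗.PiX, y ∈ 𝔗.PiYdd ↔ ι y ∈ 𝒯.PiYdd)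
    (m : ∀ M : E, (𝔗.atLevel M).muTorsion (𝔗.atLevel M).BN (𝔗.atLevel M).N ≃* (𝒯.level M).mu)
    (hχ : ∀ M : E, (𝔗.atLevel M).CyclotomicCharacterCompat (𝒯.level M) ι (m M))
    (H : ∀ M : E, (𝔗.atLevel M).Facts)
    (η : ∀ M : E, 𝒯.PiYdd → 𝒯.mu M) (hη : ∀ M, η M ∈ 𝒯.thetaCocycles M)
    (hηc : ∀ (M M' : E) (h : (M : ℕ+) ∣ M'), 𝒯.red M M' h ∘ η M' = η M)
    (hpin : ∀ M : E, (𝔗.atLevel M).ThetaSectionCompat (H M) (𝒯.level M) ι (m M) hι (η M))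
    -- étale side on the tower
    (γ : 𝒯.PiX ≃ₜ* 𝒯.PiX) (hγ : 𝒯.PiYdd.map γ.toMulEquiv.toMonoidHom = 𝒯.PiYdd)
    (hγ' : ∀ x : 𝒯.PiX, x ∈ 𝒯.PiYdd → γ x ∈ 𝒯.PiYdd) (γμ : ∀ M : E, 𝒯.mu M ≃* 𝒯.mu M)
    (hstd : ∃ cf : ∀ M : E, 𝒯.G → 𝒯.mu M,
      (∀ M, CycEnvelope.IsEnvCocycle (MonoidHom.id 𝒯.G) (𝒯.chi M) (cf M)) ∧
      (∀ M, IsLocallyConstant (cf M ∘ 𝒯.aug)) ∧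
      (∀ (M M' : E) (h : (M : ℕ+) ∣ M'), 𝒯.red M M' h ∘ cf M' = cf M) ∧
      (∀ M, 𝒯.pullbackCocycle M γ hγ (γμ M) '' 𝒯.thetaCocycles M =
        (fun η => η * (cf M ∘ 𝒯.aug ∘ 𝒯.PiYdd.subtype)) '' 𝒯.thetaCocycles M) ∧
      ∀ M : E, ∃ d : 𝒯.mu M, ∀ g : 𝒯.G, cf M g ^ 𝔗.l = CycEnvelope.coboundary (MonoidHom.id 𝒯.G) (𝒯.chi M) d g)
    (hγμχ : ∀ (M : E) (x : 𝒯.PiX) (t : 𝒯.mu M), γμ M (𝒯.chi M (𝒯.aug x) t) = 𝒯.chi M (𝒯.aug (γ x)) (γμ M t))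
    (hγμred : ∀ (M M' : E) (h : (M : ℕ+) ∣ M') (t : 𝒯.mu M'), 𝒯.red M M' h (γμ M' t) = γμ M (𝒯.red M M' h t))
    (haug : ∀ x y : 𝒯.PiX, 𝒯.aug x = 𝒯.aug y → 𝒯.aug (γ x) = 𝒯.aug (γ y))
    -- translation-freeness in étale currency: `γ^*η_M / η_M` is inflated at every level
    (hinfη : ∀ (M : E) (k k' : 𝒯.PiYdd), 𝒯.aug k = 𝒯.aug k' →
      (η M k)⁻¹ * γμ M (η M ⟨γ.symm k, 𝒯.symm_apply_mem_PiYdd_of_map_eq γ hγ k k.2⟩) =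
        (η M k')⁻¹ * γμ M (η M ⟨γ.symm k', 𝒯.symm_apply_mem_PiYdd_of_map_eq γ hγ k' k'.2⟩))
    -- separation across levels, in the REPAIRED exponent `2·l` (abc-iut-f-123's `hsepPow`, p498016)
    (hsepPow : ∀ η' : ∀ M : E, 𝒯.PiYdd → 𝒯.mu M, (∀ M, η' M ∈ 𝒯.thetaCocycles M) →
      (∀ (M M' : E) (h : (M : ℕ+) ∣ M'), 𝒯.red M M' h ∘ η' M' = η' M) →
      (∀ (M : E) (k k' : 𝒯.PiYdd), 𝒯.aug k = 𝒯.aug k' → η' M k * (η M k)⁻¹ = η' M k' * (η M k')⁻¹) →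
      ∀ M : E, ∃ d : 𝒯.mu M, ∀ k : 𝒯.PiYdd,
        (η' M k * (η M k)⁻¹) ^ (2 * 𝔗.l) = CycEnvelope.coboundary (𝒯.aug.comp 𝒯.PiYdd.subtype) (𝒯.chi M) d k)
    -- ONE transport datum at a level `N ∈ E` in the PRODUCED shape: `(a, b)`, the unit `e`, `D_c ∈ O^×(B_N)`, `D_p`, a base shadow `θ`
    {N : ℕ+} (hN : N ∈ E)
    (a : Ψ.functor.obj (𝔗.AN N) ≅ 𝔗.AN N) (b : Ψ.functor.obj (𝔗.BN N) ≅ 𝔗.BN N) (e : 𝔗.AN N ≅ 𝔗.AN N) (Dc Dp : Aut (𝔗.BN N))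
    (hDc : Dc ∈ (𝔗.atLevel N).units (𝔗.BN N))
    (θ : Aut (𝔗.pre.base.obj (𝔗.BN N)) ≃* Aut (𝔗.pre.base.obj (𝔗.BN N)))
    (hYdd : (𝔗.atLevel N).HB.map θ.toMonoidHom = (𝔗.atLevel N).HB)
    (hT : a.inv ≫ Ψ.functor.map (𝔗.sCap N) ≫ (b ≪≫ Dc.symm).hom = e.hom ≫ 𝔗.sCap N ≫ (1 : Aut (𝔗.BN N)).hom)
    (hT' : a.inv ≫ Ψ.functor.map (𝔗.sCup N) ≫ (b ≪≫ Dc.symm).hom = e.hom ≫ 𝔗.sCup N ≫ Dp.hom)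
    (hstrv : (𝔗.atLevel N).StrvTransport Ψ a e θ) (hDp : Dp ∈ (𝔗.atLevel N).units (𝔗.BN N))
    (hshadow : ∀ k : 𝔗.PiYdd, θ (𝔗.ρ N k) = 𝔗.ρ N (ι.symm (γ (ι k))))
    -- (K4m) AT `b`
    (hK4 : ∀ x : 𝒯.mu ⟨N, hN⟩, (𝔗.atLevel N).psiAut Ψ b
        (((m ⟨N, hN⟩).symm x : (𝔗.atLevel N).muTorsion (𝔗.atLevel N).BN (𝔗.atLevel N).N) : Aut (𝔗.atLevel N).BN) =
      (((m ⟨N, hN⟩).symm (γμ ⟨N, hN⟩ x) : (𝔗.atLevel N).muTorsion (𝔗.atLevel N).BN (𝔗.atLevel N).N) :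
        Aut (𝔗.atLevel N).BN)) :
    ∃ u ∈ (𝔗.atLevel N).muTorsion (𝔗.BN N) N, ∀ k : (𝔗.atLevel N).PiYdd,
      𝔗.sgpCup N ((𝔗.atLevel N).rhoYdd k) * Dp ^ (2 * 𝔗.l) * (𝔗.sgpCup N ((𝔗.atLevel N).rhoYdd k))⁻¹ * (Dp ^ (2 * 𝔗.l))⁻¹ =
        𝔗.sgpCup N ((𝔗.atLevel N).rhoYdd k) * u * (𝔗.sgpCup N ((𝔗.atLevel N).rhoYdd k))⁻¹ * u⁻¹ := by
  -- (K4m) at `b ≫ D_c⁻¹`: the values `m_N⁻¹(γ_μ x)` lie in `μ_N(B_N) ⊆ O^×(B_N)`, which is abelian and contains `D_c`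
  have hK4' : ∀ x : 𝒯.mu ⟨N, hN⟩, (𝔗.atLevel N).psiAut Ψ (b ≪≫ Dc.symm)
        (((m ⟨N, hN⟩).symm x : (𝔗.atLevel N).muTorsion (𝔗.atLevel N).BN (𝔗.atLevel N).N) : Aut (𝔗.atLevel N).BN) =
      (((m ⟨N, hN⟩).symm (γμ ⟨N, hN⟩ x) : (𝔗.atLevel N).muTorsion (𝔗.atLevel N).BN (𝔗.atLevel N).N) :
        Aut (𝔗.atLevel N).BN) := by
    intro x
    have hu : (𝔗.atLevel N).psiAut Ψ b
        (((m ⟨N, hN⟩).symm x : (𝔗.atLevel N).muTorsion (𝔗.atLevel N).BN (𝔗.atLevel N).N) : Aut (𝔗.atLevel N).BN) ∈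
          (𝔗.atLevel N).units (𝔗.BN N) := by
      rw [hK4 x]
      exact (𝔗.atLevel N).muTorsion_le_units _ _ ((m ⟨N, hN⟩).symm (γμ ⟨N, hN⟩ x)).2
    exact (ThetaFrobenioid.psiAut_trans_symm_eq_of_mem_units (𝔉 := 𝔗.atLevel N) Ψ b hDc hu).trans (hK4 x)
  exact 𝔗.kummerTorsion_of_etaleTower_of_hsepPow Ψ 𝒯 ι hι m hχ H η hη hηc hpin γ hγ hγ' γμ hstd hγμχ hγμred haug hinfη
    hsepPow hN a (b ≪≫ Dc.symm) e Dp θ hYdd hT hT' hstrv hDp hshadow hK4'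

end Generic

section Produced

variable {C : Type u} [Category.{v} C] {D : Type u'} [Category.{v'} D] (𝔗 : ThetaFrobenioidTower.{w} C D)
  (Ψ : C ≌ C) {E : Set ℕ+} (𝒯 : ThetaEnvTower.{v} E)

/-- **The member shape of `htorsfam` from the PRODUCED Thm. 5.6 data, with `hsep^{(2l)}`.**  For a family member `(a, b, w)` — `w ∈ O^×(B_N)`,
`a⁻¹ ≫ Ψ(s^⊓_N) ≫ b = s^⊓_N`, `a⁻¹ ≫ Ψ(s^⊔_N) ≫ b = s^⊔_N ≫ w` — and produced data `(θ, e, D_c, D_p)` at the member (`e ∈ O^×(A_N)`, the two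
transport equations at `b ≫ D_c⁻¹`, `D_p ∈ O^×(B_N)`, `StrvTransport Ψ a e θ`, `θ(H_{B_N}) = H_{B_N}`), the shadow law for `θ` and (K4m) at `b`,
over a tower at whose level `N` the unit discrepancy of a transported pair is intrinsic (`hδ`, [FrdI] Thm. 5.2 (i): a THEOREM for the model's
operations, `ThetaFrobenioid.eq_of_transports_of_model`), the Kummer cocycle of `w^{2l}` along `H_{B_N}` is that of a torsion unit:
`∃ u ∈ μ_N(B_N), ∀ k ∈ Π^tp_Ÿ̲, s^⊔-gp_N(ρk)·w^{2l}·s^⊔-gp_N(ρk)⁻¹·w^{−2l} = s^⊔-gp_N(ρk)·u·s^⊔-gp_N(ρk)⁻¹·u⁻¹` — VERBATIM the member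
shape of `htorsfam` of '_final_v6'.  Route: `D_c ∈ O^×(B_N)` (`mem_units_of_sCap_comp_inv_eq`), `w = D_p` (`hδ`), then
`kummerTorsion_of_etaleTower_of_trans_units_of_hsepPow`.
[cite: MochizukiEtTh2009, Thm 5.7 proof p.329–330 (PDF pp.103–104); Thm 5.6 p.328 (PDF p.102); Cor 2.19 (iii) p.291 (PDF p.65)] -/
theorem kummerTorsion_of_etaleTower_ofProduced_of_hsepPow
    -- the §5 ↔ §2 dictionary at every level `M ∈ E`
    (ι : 𝔗.PiX ≃* 𝒯.PiX) (hι : ∀ y : 𝔗.PiX, y ∈ 𝔗.PiYdd ↔ ι y ∈ 𝒯.PiYdd)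
    (m : ∀ M : E, (𝔗.atLevel M).muTorsion (𝔗.atLevel M).BN (𝔗.atLevel M).N ≃* (𝒯.level M).mu)
    (hχ : ∀ M : E, (𝔗.atLevel M).CyclotomicCharacterCompat (𝒯.level M) ι (m M))
    (H : ∀ M : E, (𝔗.atLevel M).Facts)
    (η : ∀ M : E, 𝒯.PiYdd → 𝒯.mu M) (hη : ∀ M, η M ∈ 𝒯.thetaCocycles M)
    (hηc : ∀ (M M' : E) (h : (M : ℕ+) ∣ M'), 𝒯.red M M' h ∘ η M' = η M)
    (hpin : ∀ M : E, (𝔗.atLevel M).ThetaSectionCompat (H M) (𝒯.level M) ι (m M) hι (η M))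
    -- étale side on the tower
    (γ : 𝒯.PiX ≃ₜ* 𝒯.PiX) (hγ : 𝒯.PiYdd.map γ.toMulEquiv.toMonoidHom = 𝒯.PiYdd)
    (hγ' : ∀ x : 𝒯.PiX, x ∈ 𝒯.PiYdd → γ x ∈ 𝒯.PiYdd) (γμ : ∀ M : E, 𝒯.mu M ≃* 𝒯.mu M)
    (hstd : ∃ cf : ∀ M : E, 𝒯.G → 𝒯.mu M,
      (∀ M, CycEnvelope.IsEnvCocycle (MonoidHom.id 𝒯.G) (𝒯.chi M) (cf M)) ∧
      (∀ M, IsLocallyConstant (cf M ∘ 𝒯.aug)) ∧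
      (∀ (M M' : E) (h : (M : ℕ+) ∣ M'), 𝒯.red M M' h ∘ cf M' = cf M) ∧
      (∀ M, 𝒯.pullbackCocycle M γ hγ (γμ M) '' 𝒯.thetaCocycles M =
        (fun η => η * (cf M ∘ 𝒯.aug ∘ 𝒯.PiYdd.subtype)) '' 𝒯.thetaCocycles M) ∧
      ∀ M : E, ∃ d : 𝒯.mu M, ∀ g : 𝒯.G, cf M g ^ 𝔗.l = CycEnvelope.coboundary (MonoidHom.id 𝒯.G) (𝒯.chi M) d g)
    (hγμχ : ∀ (M : E) (x : 𝒯.PiX) (t : 𝒯.mu M), γμ M (𝒯.chi M (𝒯.aug x) t) = 𝒯.chi M (𝒯.aug (γ x)) (γμ M t))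
    (hγμred : ∀ (M M' : E) (h : (M : ℕ+) ∣ M') (t : 𝒯.mu M'), 𝒯.red M M' h (γμ M' t) = γμ M (𝒯.red M M' h t))
    (haug : ∀ x y : 𝒯.PiX, 𝒯.aug x = 𝒯.aug y → 𝒯.aug (γ x) = 𝒯.aug (γ y))
    (hinfη : ∀ (M : E) (k k' : 𝒯.PiYdd), 𝒯.aug k = 𝒯.aug k' →
      (η M k)⁻¹ * γμ M (η M ⟨γ.symm k, 𝒯.symm_apply_mem_PiYdd_of_map_eq γ hγ k k.2⟩) =
        (η M k')⁻¹ * γμ M (η M ⟨γ.symm k', 𝒯.symm_apply_mem_PiYdd_of_map_eq γ hγ k' k'.2⟩))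
    (hsepPow : ∀ η' : ∀ M : E, 𝒯.PiYdd → 𝒯.mu M, (∀ M, η' M ∈ 𝒯.thetaCocycles M) →
      (∀ (M M' : E) (h : (M : ℕ+) ∣ M'), 𝒯.red M M' h ∘ η' M' = η' M) →
      (∀ (M : E) (k k' : 𝒯.PiYdd), 𝒯.aug k = 𝒯.aug k' → η' M k * (η M k)⁻¹ = η' M k' * (η M k')⁻¹) →
      ∀ M : E, ∃ d : 𝒯.mu M, ∀ k : 𝒯.PiYdd,
        (η' M k * (η M k)⁻¹) ^ (2 * 𝔗.l) = CycEnvelope.coboundary (𝒯.aug.comp 𝒯.PiYdd.subtype) (𝒯.chi M) d k)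
    -- the family MEMBER `(a, b, w)` at a level `N ∈ E` (the `htorsfam` / `hK4fam` member shape of '_final_v6')
    {N : ℕ+} (hN : N ∈ E)
    (a : Ψ.functor.obj (𝔗.AN N) ≅ 𝔗.AN N) (b : Ψ.functor.obj (𝔗.BN N) ≅ 𝔗.BN N) (w : Aut (𝔗.BN N))
    (hw : w ∈ (𝔗.atLevel N).units (𝔗.BN N))
    (hTa : a.inv ≫ Ψ.functor.map (𝔗.sCap N) ≫ b.hom = 𝔗.sCap N)
    (hTb : a.inv ≫ Ψ.functor.map (𝔗.sCup N) ≫ b.hom = 𝔗.sCup N ≫ w.hom)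
    -- the PRODUCED Thm. 5.6 data at the member: `(θ, e, D_c, D_p)`
    (θ : Aut (𝔗.pre.base.obj (𝔗.BN N)) ≃* Aut (𝔗.pre.base.obj (𝔗.BN N))) (e : 𝔗.AN N ≅ 𝔗.AN N)
    (he : e ∈ (𝔗.atLevel N).units (𝔗.AN N)) (Dc Dp : Aut (𝔗.BN N))
    (hT : a.inv ≫ Ψ.functor.map (𝔗.sCap N) ≫ (b ≪≫ Dc.symm).hom = e.hom ≫ 𝔗.sCap N ≫ (1 : Aut (𝔗.BN N)).hom)
    (hT' : a.inv ≫ Ψ.functor.map (𝔗.sCup N) ≫ (b ≪≫ Dc.symm).hom = e.hom ≫ 𝔗.sCup N ≫ Dp.hom)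
    (hDp : Dp ∈ (𝔗.atLevel N).units (𝔗.BN N)) (hstrv : (𝔗.atLevel N).StrvTransport Ψ a e θ)
    (hYdd : (𝔗.atLevel N).HB.map θ.toMonoidHom = (𝔗.atLevel N).HB)
    (hshadow : ∀ k : 𝔗.PiYdd, θ (𝔗.ρ N k) = 𝔗.ρ N (ι.symm (γ (ι k))))
    (hK4 : ∀ x : 𝒯.mu ⟨N, hN⟩, (𝔗.atLevel N).psiAut Ψ b
        (((m ⟨N, hN⟩).symm x : (𝔗.atLevel N).muTorsion (𝔗.atLevel N).BN (𝔗.atLevel N).N) : Aut (𝔗.atLevel N).BN) =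
      (((m ⟨N, hN⟩).symm (γμ ⟨N, hN⟩ x) : (𝔗.atLevel N).muTorsion (𝔗.atLevel N).BN (𝔗.atLevel N).N) :
        Aut (𝔗.atLevel N).BN))
    -- the unit discrepancy of a transported pair at level `N` is INTRINSIC ([FrdI] Thm. 5.2 (i); `eq_of_transports_of_model`)
    (hδ : ∀ {e' : 𝔗.AN N ≅ 𝔗.AN N} {w' Dc' Dp' : Aut (𝔗.BN N)}, e' ∈ (𝔗.atLevel N).units (𝔗.AN N) →
      w' ∈ (𝔗.atLevel N).units (𝔗.BN N) → Dp' ∈ (𝔗.atLevel N).units (𝔗.BN N) → 𝔗.sCap N ≫ Dc'.inv = e'.hom ≫ 𝔗.sCap N →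
      𝔗.sCup N ≫ w'.hom ≫ Dc'.inv = e'.hom ≫ 𝔗.sCup N ≫ Dp'.hom → w' = Dp') :
    ∃ u ∈ (𝔗.atLevel N).muTorsion (𝔗.BN N) N, ∀ k : (𝔗.atLevel N).PiYdd,
      𝔗.sgpCup N ((𝔗.atLevel N).rhoYdd k) * w ^ (2 * 𝔗.l) * (𝔗.sgpCup N ((𝔗.atLevel N).rhoYdd k))⁻¹ * (w ^ (2 * 𝔗.l))⁻¹ =
        𝔗.sgpCup N ((𝔗.atLevel N).rhoYdd k) * u * (𝔗.sgpCup N ((𝔗.atLevel N).rhoYdd k))⁻¹ * u⁻¹ := by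
  -- the member's equations vs the produced ones: `s^⊓_N ≫ D_c⁻¹ = e ≫ s^⊓_N`, `s^⊔_N ≫ w ≫ D_c⁻¹ = e ≫ s^⊔_N ≫ D_p`
  have h₁ : 𝔗.sCap N ≫ Dc.inv = e.hom ≫ 𝔗.sCap N :=
    calc 𝔗.sCap N ≫ Dc.inv = (a.inv ≫ Ψ.functor.map (𝔗.sCap N) ≫ b.hom) ≫ Dc.inv := by rw [hTa]
      _ = a.inv ≫ Ψ.functor.map (𝔗.sCap N) ≫ (b ≪≫ Dc.symm).hom := by
          simp only [Iso.trans_hom, Iso.symm_hom, Category.assoc]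
      _ = e.hom ≫ 𝔗.sCap N ≫ (1 : Aut (𝔗.BN N)).hom := hT
      _ = e.hom ≫ 𝔗.sCap N := by
          show e.hom ≫ 𝔗.sCap N ≫ (Iso.refl _).hom = _
          rw [Iso.refl_hom, Category.comp_id]
  have h₂ : 𝔗.sCup N ≫ w.hom ≫ Dc.inv = e.hom ≫ 𝔗.sCup N ≫ Dp.hom :=
    calc 𝔗.sCup N ≫ w.hom ≫ Dc.inv = (a.inv ≫ Ψ.functor.map (𝔗.sCup N) ≫ b.hom) ≫ Dc.inv := by
          rw [hTb]; simp only [Category.assoc]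
      _ = a.inv ≫ Ψ.functor.map (𝔗.sCup N) ≫ (b ≪≫ Dc.symm).hom := by
          simp only [Iso.trans_hom, Iso.symm_hom, Category.assoc]
      _ = e.hom ≫ 𝔗.sCup N ≫ Dp.hom := hT'
  have hDc : Dc ∈ (𝔗.atLevel N).units (𝔗.BN N) :=
    ThetaFrobenioid.mem_units_of_sCap_comp_inv_eq (𝔉 := 𝔗.atLevel N) he h₁
  -- `w = D_p` ([FrdI] Thm. 5.2 (i))
  have hwDp : w = Dp := hδ he hw hDp h₁ h₂
  rw [hwDp]
  exact 𝔗.kummerTorsion_of_etaleTower_of_trans_units_of_hsepPow Ψ 𝒯 ι hι m hχ H η hη hηc hpin γ hγ hγ' γμ hstd hγμχ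
    hγμred haug hinfη hsepPow hN a b e Dc Dp hDc θ hYdd hT hT' hstrv hDp hshadow hK4

end Produced

end ThetaFrobenioidTower

end Literature.AnabelianGeometry.EtaleTheta
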